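import Summits.HodgeConjecture.HodgeConjecture.Theorems.HolomorphicityRateRateGapOfHodgePrimitive
import Summits.HodgeConjecture.HodgeConjecture.Theorems.LinearSystemTorelliTranscendentalOrSupportedStubOfMiddleOfHodgeEffectiveAbstract
import HarnessLib

/-!
# Route `HolomorphicityRate`, crux `RateGap` (R1): the crux AS TYPED is closed modulo the existing
# crux item `MiddleDivisorSupport` (stmt-HodgeConjecture-1081) — lead c4 reshape of line `registered`

Crux item `stmt-HodgeConjecture-10762` (`HolomorphicityRate.RateGap`). The registered line closes the
crux by cancellation on the ray modulo one stub which, after the reshapes of leads c1–c3, is the Hodge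
conjecture for primitive middle-dimensional rational classes (`hodgeConjecture_iff_hodgePrimitiveMiddle`,
file `HolomorphicityRateRateGapOfHodgePrimitive`). This file records that the residual stub is — by
theorems already in the tree — the same proposition as an EXISTING ledger item wanted by three other
routes: crux `MiddleDivisorSupport` (stmt-HodgeConjecture-1081; routes `NodalSupport`,
`LinearSystemTorelli`, `LimitExtension`): *every rational `(p,p)` class in the middle degree of a smooth
projective `2p`-fold, `p ≥ 1`, is supported on a divisor (`∈ N¹H²ᵖ`)*, which Thomas (2005, Thm. 1)
showed equivalent to the Hodge conjecture and which the tree certifies so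
(`middleDivisorSupport_iff_hodgeConjecture`: the closed reduction chain divisor induction / Lefschetz
pencils / hard Lefschetz of route `LinearSystemTorelli`, and `Nᵖ ⊆ N¹`).

Results (helpers towards the crux, `--supports stmt-HodgeConjecture-10762`; pure composition of landed
theorems, no new mathematics):

* `rateGap_of_middleDivisorSupport` — item 1081 (`LinearSystemTorelli.MiddleDivisorSupport`) ⟹ the
  crux `HolomorphicityRate.RateGap`; `rateGap_of_nodalSupport_middleDivisorSupport` — the same from the
  `NodalSupport` copy of the decl (the crux decl of 1081's own registered line);
  `rateGap_of_middleDivisorSupport_signature` — the same with item 1081's SIGNATURE verbatim as the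
  hypothesis (the registered sub-goal of the reshaped skeleton: its one stub is that signature);
* `hodgePrimitiveMiddle_of_middleDivisorSupport`, `middleDivisorSupport_of_hodgePrimitiveMiddle`,
  `hodgePrimitiveMiddle_iff_middleDivisorSupport` — the c3 stub and item 1081 are equivalent (both are
  equivalent to `_root_.HodgeConjecture`).

Consequence for the ledger: `RateGap` as typed hinges on exactly one existing open item, 1081; it is
implied by it (this file) and implies nothing towards it without the sibling crux
`SuperThresholdRigidity` (route `closes`; EQUIVALENCE-AUDIT of the crux).

## References

* R. Thomas, *Nodes and the Hodge conjecture*, J. Algebraic Geom. 14 (2005), Thm. 1 and Prop. 2.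
* A. Grothendieck, *Hodge's general conjecture is false for trivial reasons*, Topology 8 (1969), §1.
* P. Deligne, *The Hodge conjecture*, Clay problem description (2000), §1.
* M. Kerr, G. Pearlstein, *An exponential history of functions with logarithmic growth* (2011), §3.1.
-/

noncomputable section

set_option linter.dupNamespace false

namespace Summit.HodgeConjecture.HodgeConjecture.Theorems

open Literature.AlgebraicGeometry.HodgeTheory Literature.AlgebraicGeometry.Motives

/-- **Item 1081 implies the crux.** `MiddleDivisorSupport` (stmt-HodgeConjecture-1081, the
`LinearSystemTorelli` decl) gives the Hodge conjecture (`hodgeConjecture_of_middleDivisorSupport`: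
divisor induction, Lefschetz pencils below the middle, hard Lefschetz above it — Thomas 2005 Thm. 1 in
the tree's divisor-support form), and the Hodge conjecture gives `RateGap` by cancellation on the ray
over a holomorphic cycle support (`rateGap_of_hodgeConjecture`). [cite: Thomas2005Nodes, Thm. 1]
[cite: Deligne2000, §1] -/
theorem rateGap_of_middleDivisorSupport
    (hMid : Summit.HodgeConjecture.HodgeConjecture.Theses.LinearSystemTorelli.MiddleDivisorSupport) :
    Summit.HodgeConjecture.HodgeConjecture.Theses.HolomorphicityRate.RateGap :=
  rateGap_of_hodgeConjecture (hodgeConjecture_of_middleDivisorSupport hMid)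

/-- **Item 1081 implies the crux**, from the `NodalSupport` copy of the decl `MiddleDivisorSupport`
(the crux decl of item 1081's registered line; both route copies unfold to the one signature of the
item). [cite: Thomas2005Nodes, Thm. 1] -/
theorem rateGap_of_nodalSupport_middleDivisorSupport
    (hMid : Summit.HodgeConjecture.HodgeConjecture.Theses.NodalSupport.MiddleDivisorSupport) :
    Summit.HodgeConjecture.HodgeConjecture.Theses.HolomorphicityRate.RateGap := by
  unfold Summit.HodgeConjecture.HodgeConjecture.Theses.NodalSupport.MiddleDivisorSupport at hMid
  exact rateGap_of_middleDivisorSupport hMid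

/-- **The registered sub-goal of the reshaped line `registered` (lead c4):** the crux from its one
stub, whose statement is the SIGNATURE of item stmt-HodgeConjecture-1081 verbatim (every rational
`(p,p)` class in the middle degree of a smooth projective `2p`-fold, `p ≥ 1`, lies in `N¹H²ᵖ`).
[cite: Thomas2005Nodes, Thm. 1] [cite: GrothendieckTopology1969, §1] -/
theorem rateGap_of_middleDivisorSupport_signature :
    (∀ ⦃p : ℕ⦄ ⦃X : Literature.AlgebraicGeometry.Motives.SchemeOver ℂ⦄, 1 ≤ p → Literature.AlgebraicGeometry.Motives.IsSmoothProjective (2 * p) X → ∀ c : Literature.AlgebraicGeometry.HodgeTheory.complexBetti X (2 * p), Literature.AlgebraicGeometry.HodgeTheory.IsRationalClass c → Literature.AlgebraicGeometry.HodgeTheory.IsOfHodgeType (2 * p) X (2 * p) p p c → c ∈ Literature.AlgebraicGeometry.HodgeTheory.supportedClasses X (2 * p) 1) →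
      Summit.HodgeConjecture.HodgeConjecture.Theses.HolomorphicityRate.RateGap :=
  fun hMid => rateGap_of_middleDivisorSupport hMid

/-- **Item 1081 implies the primitive middle stub of lead c3** (through the Hodge conjecture:
`hodgeConjecture_of_middleDivisorSupport`, then `hodgePrimitiveMiddle_of_hodgeConjecture`).
[cite: Thomas2005Nodes, Thm. 1] [cite: KerrPearlstein2011, §3.1] -/
theorem hodgePrimitiveMiddle_of_middleDivisorSupport
    (hMid : Summit.HodgeConjecture.HodgeConjecture.Theses.LinearSystemTorelli.MiddleDivisorSupport) :
    ∀ (m : ℕ) (X : Literature.AlgebraicGeometry.Motives.SchemeOver ℂ), Literature.AlgebraicGeometry.Motives.IsSmoothProjective (2 * m) X → 2 ≤ m → ∀ (Λ : Literature.AlgebraicGeometry.HodgeTheory.HardLefschetzNFold (2 * m) X) (A : Literature.AlgebraicGeometry.HodgeTheory.HodgeModel (2 * m) X) (c : Literature.AlgebraicGeometry.HodgeTheory.complexBetti X (2 * m)), Literature.AlgebraicGeometry.HodgeTheory.IsRationalClass c → A.pullback (2 * m) c ∈ A.hodgePQ (2 * m) m m → Literature.Geometry.Kaehler.lefschetzOperator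 Λ.hyperplaneClass (Literature.AlgebraicGeometry.HodgeTheory.two_add_two_mul m) c = 0 → c ∈ Literature.AlgebraicGeometry.HodgeTheory.algebraicClasses X m :=
  hodgePrimitiveMiddle_of_hodgeConjecture (hodgeConjecture_of_middleDivisorSupport hMid)

/-- **The primitive middle stub of lead c3 implies item 1081** (through the Hodge conjecture:
`hodgeConjecture_of_hodgePrimitiveMiddle`, then `middleDivisorSupport_of_hodgeConjecture`, i.e.
`Nᵖ ⊆ N¹` for `p ≥ 1`). [cite: KerrPearlstein2011, §3.1] [cite: GrothendieckTopology1969, §1] -/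
theorem middleDivisorSupport_of_hodgePrimitiveMiddle
    (hP : ∀ (m : ℕ) (X : Literature.AlgebraicGeometry.Motives.SchemeOver ℂ), Literature.AlgebraicGeometry.Motives.IsSmoothProjective (2 * m) X → 2 ≤ m → ∀ (Λ : Literature.AlgebraicGeometry.HodgeTheory.HardLefschetzNFold (2 * m) X) (A : Literature.AlgebraicGeometry.HodgeTheory.HodgeModel (2 * m) X) (c : Literature.AlgebraicGeometry.HodgeTheory.complexBetti X (2 * m)), Literature.AlgebraicGeometry.HodgeTheory.IsRationalClass c → A.pullback (2 * m) c ∈ A.hodgePQ (2 * m) m m → Literature.Geometry.Kaehler.lefschetzOperator Λ.hyperplaneClass (Literature.AlgebraicGeometry.HodgeTheory.two_add_two_mul m) c = 0 → c ∈ Literature.AlgebraicGeometry.HodgeTheory.algebraicClasses X m) :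
    Summit.HodgeConjecture.HodgeConjecture.Theses.LinearSystemTorelli.MiddleDivisorSupport :=
  middleDivisorSupport_of_hodgeConjecture (hodgeConjecture_of_hodgePrimitiveMiddle hP)

/-- **Certificate of the c4 reshape: the primitive middle stub of line `registered` is EQUIVALENT to
item stmt-HodgeConjecture-1081 `MiddleDivisorSupport`** (both are equivalent to
`_root_.HodgeConjecture`: `hodgeConjecture_iff_hodgePrimitiveMiddle`,
`middleDivisorSupport_iff_hodgeConjecture`). [cite: Thomas2005Nodes, Thm. 1]
[cite: KerrPearlstein2011, §3.1] -/
theorem hodgePrimitiveMiddle_iff_middleDivisorSupport :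
    (∀ (m : ℕ) (X : Literature.AlgebraicGeometry.Motives.SchemeOver ℂ), Literature.AlgebraicGeometry.Motives.IsSmoothProjective (2 * m) X → 2 ≤ m → ∀ (Λ : Literature.AlgebraicGeometry.HodgeTheory.HardLefschetzNFold (2 * m) X) (A : Literature.AlgebraicGeometry.HodgeTheory.HodgeModel (2 * m) X) (c : Literature.AlgebraicGeometry.HodgeTheory.complexBetti X (2 * m)), Literature.AlgebraicGeometry.HodgeTheory.IsRationalClass c → A.pullback (2 * m) c ∈ A.hodgePQ (2 * m) m m → Literature.Geometry.Kaehler.lefschetzOperator Λ.hyperplaneClass (Literature.AlgebraicGeometry.HodgeTheory.two_add_two_mul m) c = 0 → c ∈ Literature.AlgebraicGeometry.HodgeTheory.algebraicClasses X m) ↔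
      Summit.HodgeConjecture.HodgeConjecture.Theses.LinearSystemTorelli.MiddleDivisorSupport :=
  ⟨middleDivisorSupport_of_hodgePrimitiveMiddle, hodgePrimitiveMiddle_of_middleDivisorSupport⟩

end Summit.HodgeConjecture.HodgeConjecture.Theorems

end
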